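import Summits.CriticalPhenomena.PercolationContinuityZ3.Theorems.Transplant.FKConnectivityAllQForestAdjacentTriangleCluster
import HarnessLib

/-!
# The fan of length two (`e = ov`, `h = ox`, `f = oy`, `p = vx`, `q = xy`): tools, inside facts and the first three toggle pieces

Support file (`--supports stmt-CriticalPhenomena-4575`), FK sub-lane `prim-bschramm-fk-1` (gen 21) of the post-continuity programme;
builds on p205010 (kernel theorem, internal audit signed; external expert review pending).  No definitions, no named facts, no sorries;
standard axioms.  Part 1 of 2 (`…ForestAdjacentFanTwo` assembles).

GOAL (the two files together): the square-free adjacent forest Rayleigh inequality — `AdjForestRayleighNoSqOn`'s inequality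
`#(Fo ∩ {e, f ∈ ω}, Fo) ≤ #(Fo ∩ {e ∈ ω}, Fo ∩ {f ∈ ω})`, i.e. negative correlation of `e = ov`, `f = oy` in the uniform ordered
two-forest partition of a finite multigraph — on every fibre containing the fan `o ∗ (v x y)`: `v` and `y` have a common neighbour `x`
adjacent to `o`.  This is the case ℓ = 2 of the lineage's LOCALLY-CONNECTED THEOREM (memo bschramm/FROM-fk-1-g21-SIGMA-EXCHANGE.md §3:
(♣)⁰ at `(o; v, y)` whenever `v, y` lie in one component of `G[N(o)]`; ℓ = 1 is `…ForestAdjacentTriangle`).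
METHOD (near-tight gadgets written as one global σ-equivariant injection): the fan `U = {o, v, x, y}` carries `5 = 2·4 − 3` inside
pairs, so in every counted pair `(ω, ω ∆ M)` one class holds a spanning tree of `U`, the other a two-component forest; a bad `ω ∋ e, f`
has exactly one of the four inside types `p ∈ ω` / `q ∈ ω` / `h ∈ ω` / none, and is sent to a good pair by ONE of the two fan toggles
`f ↔ q` (`ι`) or `e ↔ p` (`ι'`, followed by the swap `ω ↦ ω ∆ M`), the choice depending on the type and one reachability bit of the
outside; the six pieces land injectively in six pairwise disjoint parts of the good pairs.
THIS FILE: `not_reachable_sdiff_singleton_of_mem`, `mem_symmDiff_iff_not_mem`, **`fibreCount_exchange_le_of`**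
(gen 21's exchange injection with caller-chosen targets), `reach_of_mem{_sdiff,_sdiff₂}`; distinctness of the five fan pairs; the
inside exclusions (`h ∈ ω ⇒ p, q ∉ ω`; `p ∈ ω ⇒ h, q ∉ ω`; `q ∈ ω ⇒ h, p ∉ ω` — triangles `vox`, `xoy`, square `ovxy`);
`fibreCount_split_pred`; pieces **`fanTwo_piece_p`** (`ι`), **`fanTwo_piece_q`** (`ι'`), **`fanTwo_piece_h_pos`** (`ι`, partner joins
`o, v` off `{p, q}`).
[cite: SempleWelsh2008, Conj. 1.1 (p. 2); Thm. 4.2 (p. 11)] [cite: Linusson2011, Prop. 2.6] [cite: Grimmett2006, §1.5 (p. 13)]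
-/

noncomputable section

namespace Summit.CriticalPhenomena.PercolationContinuityZ3.Theorems
namespace FK

open MeasureTheory Set Literature.Probability.LatticeModels Literature.Probability.Percolation
open scoped Classical symmDiff

variable {V : Type*} [Fintype V]

/-! ### Tools -/

section Tools

variable {M u₀ : BondConfig V}

omit [Fintype V] in
/-- **Removing a pair of a forest separates its ends.** [cite: Grimmett2006, §1.5 (p. 13)] -/
theorem not_reachable_sdiff_singleton_of_mem {ω : BondConfig V} {a b : V} (hF : IsForestCfg ω) (hab : a ≠ b) (h : s(a, b) ∈ ω) :
    ¬ (openGraph (ω \ {s(a, b)})).Reachable a b := by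
  have h' : s(a, b) ∉ ω \ {s(a, b)} := fun h' => h'.2 rfl
  have hback : insert s(a, b) (ω \ {s(a, b)}) = ω := by rw [insert_sdiff_singleton, insert_eq_of_mem h]
  have hF' : IsForestCfg (insert s(a, b) (ω \ {s(a, b)})) := by rwa [hback]
  exact ((isForestCfg_insert_iff hab h').1 hF').2

omit [Fintype V] in
/-- A free pair lies in the partner iff it does not lie in the configuration. [folklore] -/
theorem mem_symmDiff_iff_not_mem {ω : BondConfig V} {z : Sym2 V} (hz : z ∈ M) : z ∈ ω ∆ M ↔ z ∉ ω := by
  rw [Set.mem_symmDiff]; tauto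

omit [Fintype V] in
/-- A present pair stays present off two other pairs. [folklore] -/
theorem mem_sdiff_sdiff_of_ne {ω : BondConfig V} {z a b : Sym2 V} (hz : z ∈ ω) (hza : z ≠ a) (hzb : z ≠ b) : z ∈ (ω \ {a}) \ {b} :=
  ⟨⟨hz, hza⟩, hzb⟩

/-- **The exchange injection, generic targets**: for free pairs `a ≠ g` of `M`, if every counted `ω` of the source holds `a`, misses
`g`, and its exchange `(ω ∖ {a}) ∪ {g}` (with partner `((ω ∆ M) ∖ {g}) ∪ {a}`) lands in the target pair of events, then the source count
is at most the target count. [cite: Linusson2011, Prop. 2.6] -/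
theorem fibreCount_exchange_le_of {a g : Sym2 V} (haM : a ∈ M) (hgM : g ∈ M) {S B₀ A' B' : Set (BondConfig V)}
    (h : ∀ ω, ω \ M = u₀ → ω ∈ S → ω ∆ M ∈ B₀ →
      a ∈ ω ∧ g ∉ ω ∧ insert g (ω \ {a}) ∈ A' ∧ insert a ((ω ∆ M) \ {g}) ∈ B') :
    fibreCount M u₀ S B₀ ≤ fibreCount M u₀ A' B' := by
  refine fibreCount_le_of_injOn (fun ω => insert g (ω \ {a})) (fun ω hω hA hB => ?_) (fun ω ω' hω hA hB hω' hA' hB' he => ?_)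
  · obtain ⟨ha, hg, hA', hB'⟩ := h ω hω hA hB
    exact ⟨by rw [insert_sdiff_singleton_sdiff haM hgM, hω], hA', by rw [insert_sdiff_singleton_symmDiff haM hgM ha hg]; exact hB'⟩
  · obtain ⟨ha, hg, -, -⟩ := h ω hω hA hB
    obtain ⟨ha', hg', -, -⟩ := h ω' hω' hA' hB'
    rw [← insert_sdiff_insert_sdiff_cancel ha hg, ← insert_sdiff_insert_sdiff_cancel ha' hg']
    exact congrArg (fun s => insert a (s \ {g})) he

omit [Fintype V] in
/-- A present genuine pair joins its ends. [folklore] -/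
theorem reach_of_mem {ω : BondConfig V} {a b : V} (h : s(a, b) ∈ ω) (hab : a ≠ b) : (openGraph ω).Reachable a b :=
  ((openGraph_adj _ _ _).2 ⟨h, hab⟩).reachable

omit [Fintype V] in
/-- A present genuine pair joins its ends off another pair. [folklore] -/
theorem reach_of_mem_sdiff {ω : BondConfig V} {a b : V} {c : Sym2 V} (h : s(a, b) ∈ ω) (hab : a ≠ b) (hc : s(a, b) ≠ c) :
    (openGraph (ω \ {c})).Reachable a b :=
  reach_of_mem (ω := ω \ {c}) ⟨h, hc⟩ hab

omit [Fintype V] in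
/-- A present genuine pair joins its ends off two other pairs. [folklore] -/
theorem reach_of_mem_sdiff₂ {ω : BondConfig V} {a b : V} {c d : Sym2 V} (h : s(a, b) ∈ ω) (hab : a ≠ b) (hc : s(a, b) ≠ c)
    (hd : s(a, b) ≠ d) : (openGraph ((ω \ {c}) \ {d})).Reachable a b :=
  reach_of_mem (ω := (ω \ {c}) \ {d}) ⟨⟨h, hc⟩, hd⟩ hab

end Tools

/-! ### The fan of length two -/

section FanTwo

variable {M u₀ : BondConfig V} {o v x y : V}

/-! #### Distinctness of the five fan pairs -/

omit [Fintype V] in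
/-- `e ≠ f`. [folklore] -/
theorem fanTwo_e_ne_f (hvy : v ≠ y) : s(o, v) ≠ s(o, y) := fun h => hvy (Sym2.congr_right.1 h)
omit [Fintype V] in
/-- `e ≠ h`. [folklore] -/
theorem fanTwo_e_ne_h (hvx : v ≠ x) : s(o, v) ≠ s(o, x) := fun h => hvx (Sym2.congr_right.1 h)
omit [Fintype V] in
/-- `h ≠ f`. [folklore] -/
theorem fanTwo_h_ne_f (hxy : x ≠ y) : s(o, x) ≠ s(o, y) := fun h => hxy (Sym2.congr_right.1 h)
omit [Fintype V] in
/-- `e ≠ p`. [folklore] -/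
theorem fanTwo_e_ne_p (hov : o ≠ v) (hox : o ≠ x) : s(o, v) ≠ s(v, x) := fun h => by
  rcases Sym2.eq_iff.1 h with ⟨h1, -⟩ | ⟨h1, -⟩
  · exact hov h1
  · exact hox h1
omit [Fintype V] in
/-- `e ≠ q`. [folklore] -/
theorem fanTwo_e_ne_q (hox : o ≠ x) (hoy : o ≠ y) : s(o, v) ≠ s(x, y) := fun h => by
  rcases Sym2.eq_iff.1 h with ⟨h1, -⟩ | ⟨h1, -⟩
  · exact hox h1
  · exact hoy h1
omit [Fintype V] in
/-- `f ≠ p`. [folklore] -/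
theorem fanTwo_f_ne_p (hov : o ≠ v) (hox : o ≠ x) : s(o, y) ≠ s(v, x) := fun h => by
  rcases Sym2.eq_iff.1 h with ⟨h1, -⟩ | ⟨h1, -⟩
  · exact hov h1
  · exact hox h1
omit [Fintype V] in
/-- `f ≠ q`. [folklore] -/
theorem fanTwo_f_ne_q (hox : o ≠ x) : s(o, y) ≠ s(x, y) := fun h => hox (Sym2.congr_left.1 h)
omit [Fintype V] in
/-- `h ≠ p`. [folklore] -/
theorem fanTwo_h_ne_p (hov : o ≠ v) : s(o, x) ≠ s(v, x) := fun h => hov (Sym2.congr_left.1 h)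
omit [Fintype V] in
/-- `h ≠ q`. [folklore] -/
theorem fanTwo_h_ne_q (hox : o ≠ x) (hoy : o ≠ y) : s(o, x) ≠ s(x, y) := fun h => by
  rcases Sym2.eq_iff.1 h with ⟨h1, -⟩ | ⟨h1, -⟩
  · exact hox h1
  · exact hoy h1
omit [Fintype V] in
/-- `p ≠ q`. [folklore] -/
theorem fanTwo_p_ne_q (hvx : v ≠ x) (hvy : v ≠ y) : s(v, x) ≠ s(x, y) := fun h => by
  rcases Sym2.eq_iff.1 h with ⟨h1, -⟩ | ⟨h1, -⟩
  · exact hvx h1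
  · exact hvy h1

/-! #### Inside facts for a bad pair (`e, f ∈ ω ∈ Fo`) -/

section Inside

variable {ω : BondConfig V}

omit [Fintype V] in
/-- `h ∈ ω` excludes `p` (triangle `v o x`). [cite: Grimmett2006, §1.5 (p. 13)] -/
theorem fanTwo_p_notMem_of_h (hov : o ≠ v) (hox : o ≠ x) (hvx : v ≠ x) (hF : IsForestCfg ω) (he : s(o, v) ∈ ω)
    (hh : s(o, x) ∈ ω) : s(v, x) ∉ ω := by
  intro hp
  have he' : s(v, o) ∈ ω := by rw [Sym2.eq_swap]; exact he
  exact not_mem_of_isForestCfg_of_two_mem hov.symm hvx hox hF he' hp hh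

omit [Fintype V] in
/-- `p ∈ ω` excludes `h` (the same triangle). [cite: Grimmett2006, §1.5 (p. 13)] -/
theorem fanTwo_h_notMem_of_p (hov : o ≠ v) (hox : o ≠ x) (hvx : v ≠ x) (hF : IsForestCfg ω) (he : s(o, v) ∈ ω)
    (hp : s(v, x) ∈ ω) : s(o, x) ∉ ω :=
  fun hh => fanTwo_p_notMem_of_h hov hox hvx hF he hh hp

omit [Fintype V] in
/-- `h ∈ ω` excludes `q` (triangle `x o y`). [cite: Grimmett2006, §1.5 (p. 13)] -/
theorem fanTwo_q_notMem_of_h (hox : o ≠ x) (hoy : o ≠ y) (hxy : x ≠ y) (hF : IsForestCfg ω) (hf : s(o, y) ∈ ω)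
    (hh : s(o, x) ∈ ω) : s(x, y) ∉ ω := by
  intro hq
  have hh' : s(x, o) ∈ ω := by rw [Sym2.eq_swap]; exact hh
  exact not_mem_of_isForestCfg_of_two_mem hox.symm hxy hoy hF hh' hq hf

omit [Fintype V] in
/-- `q ∈ ω` excludes `h` (the same triangle). [cite: Grimmett2006, §1.5 (p. 13)] -/
theorem fanTwo_h_notMem_of_q (hox : o ≠ x) (hoy : o ≠ y) (hxy : x ≠ y) (hF : IsForestCfg ω) (hf : s(o, y) ∈ ω)
    (hq : s(x, y) ∈ ω) : s(o, x) ∉ ω :=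
  fun hh => fanTwo_q_notMem_of_h hox hoy hxy hF hf hh hq

omit [Fintype V] in
/-- `p ∈ ω` excludes `q` (square `o v x y`). [cite: Grimmett2006, §1.5 (p. 13)] -/
theorem fanTwo_q_notMem_of_p (hov : o ≠ v) (hox : o ≠ x) (hoy : o ≠ y) (hvx : v ≠ x) (hvy : v ≠ y) (hxy : x ≠ y)
    (hF : IsForestCfg ω) (he : s(o, v) ∈ ω) (hf : s(o, y) ∈ ω) (hp : s(v, x) ∈ ω) : s(x, y) ∉ ω := by
  intro hq
  have hp' : s(x, v) ∈ ω := by rw [Sym2.eq_swap]; exact hp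
  have he' : s(v, o) ∈ ω := by rw [Sym2.eq_swap]; exact he
  have h1 : (openGraph (ω \ {s(x, y)})).Reachable x v :=
    reach_of_mem_sdiff hp' hvx.symm (by rw [Sym2.eq_swap]; exact fanTwo_p_ne_q hvx hvy)
  have h2 : (openGraph (ω \ {s(x, y)})).Reachable v o :=
    reach_of_mem_sdiff he' hov.symm (by rw [Sym2.eq_swap]; exact fanTwo_e_ne_q hox hoy)
  have h3 : (openGraph (ω \ {s(x, y)})).Reachable o y := reach_of_mem_sdiff hf hoy (fanTwo_f_ne_q hox)
  exact not_reachable_sdiff_singleton_of_mem hF hxy hq ((h1.trans h2).trans h3)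

omit [Fintype V] in
/-- `q ∈ ω` excludes `p` (the same square). [cite: Grimmett2006, §1.5 (p. 13)] -/
theorem fanTwo_p_notMem_of_q (hov : o ≠ v) (hox : o ≠ x) (hoy : o ≠ y) (hvx : v ≠ x) (hvy : v ≠ y) (hxy : x ≠ y)
    (hF : IsForestCfg ω) (he : s(o, v) ∈ ω) (hf : s(o, y) ∈ ω) (hq : s(x, y) ∈ ω) : s(v, x) ∉ ω :=
  fun hp => fanTwo_q_notMem_of_p hov hox hoy hvx hvy hxy hF he hf hp hq

end Inside

/-! #### A predicate split of a fibre count -/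

omit [Fintype V] in
/-- `(A ∩ C) ∪ (A ∩ Cᶜ) = A`. [folklore] -/
theorem inter_union_inter_compl (A C : Set (BondConfig V)) : (A ∩ C) ∪ (A ∩ Cᶜ) = A := by
  rw [← inter_union_distrib_left, union_compl_self, inter_univ]

/-- Splitting the first event of a fibre count by a predicate. [cite: Linusson2011, Prop. 2.6] -/
theorem fibreCount_split_pred (M u : BondConfig V) (A B C : Set (BondConfig V)) :
    fibreCount M u A B = fibreCount M u (A ∩ C) B + fibreCount M u (A ∩ Cᶜ) B := by
  rw [← fibreCount_split_left _ _ _ (Set.disjoint_left.2 fun ω h₁ h₂ => h₂.2 h₁.2), inter_union_inter_compl]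

/-! #### The six pieces -/

section Pieces

variable (hov : o ≠ v) (hox : o ≠ x) (hoy : o ≠ y) (hvx : v ≠ x) (hvy : v ≠ y) (hxy : x ≠ y)
  (heM : s(o, v) ∈ M) (hhM : s(o, x) ∈ M) (hfM : s(o, y) ∈ M) (hpM : s(v, x) ∈ M) (hqM : s(x, y) ∈ M)
include hov hox hoy hvx hvy hxy heM hhM hfM hpM hqM

omit heM hpM in
/-- **Piece `p ∈ ω`** (inside tree `{e, f, p}`): toggle `f ↔ q`; lands in `{q, p ∈ ω', h ∉ ω'}`.
[cite: Linusson2011, Prop. 2.6] [cite: Grimmett2006, §1.5 (p. 13)] -/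
theorem fanTwo_piece_p :
    fibreCount M u₀ (forestEv V ∩ {ω | s(o, v) ∈ ω ∧ s(o, y) ∈ ω} ∩ {ω | s(v, x) ∈ ω}) (forestEv V) ≤
      fibreCount M u₀ (forestEv V ∩ {ω | s(o, v) ∈ ω} ∩ {ω | s(x, y) ∈ ω} ∩ {ω | s(o, x) ∈ ω}ᶜ ∩ {ω | s(v, x) ∈ ω})
        (forestEv V ∩ {ω | s(o, y) ∈ ω}) := by
  refine fibreCount_exchange_le_of hfM hqM fun ω hω hA hB => ?_
  obtain ⟨⟨hF, he, hf⟩, hp⟩ := hA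
  have hB' : IsForestCfg (ω ∆ M) := hB
  have hq : s(x, y) ∉ ω := fanTwo_q_notMem_of_p hov hox hoy hvx hvy hxy hF he hf hp
  have hh : s(o, x) ∉ ω := fanTwo_h_notMem_of_p hov hox hvx hF he hp
  have hqB : s(x, y) ∈ ω ∆ M := (mem_symmDiff_iff_not_mem hqM).2 hq
  have hhB : s(o, x) ∈ ω ∆ M := (mem_symmDiff_iff_not_mem hhM).2 hh
  have hfB : s(o, y) ∉ (ω ∆ M) \ {s(x, y)} := fun h => ((mem_symmDiff_iff_not_mem hfM).1 h.1) hf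
  have hsepA : ¬ (openGraph (ω \ {s(o, y)})).Reachable x y := by
    intro hr
    have hxv : (openGraph (ω \ {s(o, y)})).Reachable x v :=
      reach_of_mem_sdiff (by rw [Sym2.eq_swap]; exact hp) hvx.symm (by rw [Sym2.eq_swap]; exact (fanTwo_f_ne_p hov hox).symm)
    have hvo : (openGraph (ω \ {s(o, y)})).Reachable v o :=
      reach_of_mem_sdiff (by rw [Sym2.eq_swap]; exact he) hov.symm (by rw [Sym2.eq_swap]; exact fanTwo_e_ne_f hvy)
    exact not_reachable_sdiff_singleton_of_mem hF hoy hf ((hxv.trans hvo).symm.trans hr)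
  have hsepB : ¬ (openGraph ((ω ∆ M) \ {s(x, y)})).Reachable o y := by
    intro hr
    have hxo : (openGraph ((ω ∆ M) \ {s(x, y)})).Reachable x o :=
      reach_of_mem_sdiff (by rw [Sym2.eq_swap]; exact hhB) hox.symm (by rw [Sym2.eq_swap]; exact fanTwo_h_ne_q hox hoy)
    exact not_reachable_sdiff_singleton_of_mem hB' hxy hqB (hxo.trans hr)
  refine ⟨hf, hq, ⟨⟨⟨⟨?_, mem_insert_of_mem _ ⟨he, fanTwo_e_ne_f hvy⟩⟩, mem_insert _ _⟩, ?_⟩,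
    mem_insert_of_mem _ ⟨hp, (fanTwo_f_ne_p hov hox).symm⟩⟩, ?_, mem_insert _ _⟩
  · exact (isForestCfg_insert_iff hxy fun h => hq h.1).2 ⟨isForestCfg_of_subset hF sdiff_subset, hsepA⟩
  · rintro (h | h)
    · exact fanTwo_h_ne_q hox hoy h
    · exact hh h.1
  · exact (isForestCfg_insert_iff hoy hfB).2 ⟨isForestCfg_of_subset hB' sdiff_subset, hsepB⟩

omit hfM in
/-- **Piece `q ∈ ω`** (inside tree `{e, f, q}`): toggle `e ↔ p`, then swap; lands in `{h ∈ ω', p, q ∉ ω'}`.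
[cite: Linusson2011, Prop. 2.6] [cite: Grimmett2006, §1.5 (p. 13)] -/
theorem fanTwo_piece_q :
    fibreCount M u₀ (forestEv V ∩ {ω | s(o, v) ∈ ω ∧ s(o, y) ∈ ω} ∩ {ω | s(v, x) ∈ ω}ᶜ ∩ {ω | s(x, y) ∈ ω}) (forestEv V) ≤
      fibreCount M u₀ (forestEv V ∩ {ω | s(o, v) ∈ ω} ∩ {ω | s(x, y) ∈ ω}ᶜ ∩ {ω | s(o, x) ∈ ω} ∩ {ω | s(v, x) ∈ ω}ᶜ)
        (forestEv V ∩ {ω | s(o, y) ∈ ω}) := by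
  refine le_trans (fibreCount_exchange_le_of heM hpM fun ω hω hA hB => ?_) (le_of_eq (fibreCount_swap _ _ _ _))
  obtain ⟨⟨⟨hF, he, hf⟩, hp⟩, hq⟩ := hA
  have hp : s(v, x) ∉ ω := hp
  have hB' : IsForestCfg (ω ∆ M) := hB
  have hh : s(o, x) ∉ ω := fanTwo_h_notMem_of_q hox hoy hxy hF hf hq
  have hpB : s(v, x) ∈ ω ∆ M := (mem_symmDiff_iff_not_mem hpM).2 hp
  have hhB : s(o, x) ∈ ω ∆ M := (mem_symmDiff_iff_not_mem hhM).2 hh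
  have hqB : s(x, y) ∉ ω ∆ M := fun h => ((mem_symmDiff_iff_not_mem hqM).1 h) hq
  have heB : s(o, v) ∉ (ω ∆ M) \ {s(v, x)} := fun h => ((mem_symmDiff_iff_not_mem heM).1 h.1) he
  have hsepA : ¬ (openGraph (ω \ {s(o, v)})).Reachable v x := by
    intro hr
    have hxy' : (openGraph (ω \ {s(o, v)})).Reachable x y := reach_of_mem_sdiff hq hxy (fanTwo_e_ne_q hox hoy).symm
    have hyo : (openGraph (ω \ {s(o, v)})).Reachable y o :=
      reach_of_mem_sdiff (by rw [Sym2.eq_swap]; exact hf) hoy.symm (by rw [Sym2.eq_swap]; exact (fanTwo_e_ne_f hvy).symm)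
    exact not_reachable_sdiff_singleton_of_mem hF hov he ((hr.trans hxy').trans hyo).symm
  have hsepB : ¬ (openGraph ((ω ∆ M) \ {s(v, x)})).Reachable o v := by
    intro hr
    have hxo : (openGraph ((ω ∆ M) \ {s(v, x)})).Reachable x o :=
      reach_of_mem_sdiff (by rw [Sym2.eq_swap]; exact hhB) hox.symm (by rw [Sym2.eq_swap]; exact fanTwo_h_ne_p hov)
    exact not_reachable_sdiff_singleton_of_mem hB' hvx hpB (hxo.trans hr).symm
  refine ⟨he, hp, ⟨?_, mem_insert_of_mem _ ⟨hf, (fanTwo_e_ne_f hvy).symm⟩⟩, ⟨⟨⟨⟨?_, mem_insert _ _⟩, ?_⟩, ?_⟩, ?_⟩⟩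
  · exact (isForestCfg_insert_iff hvx fun h => hp h.1).2 ⟨isForestCfg_of_subset hF sdiff_subset, hsepA⟩
  · exact (isForestCfg_insert_iff hov heB).2 ⟨isForestCfg_of_subset hB' sdiff_subset, hsepB⟩
  · rintro (h | h)
    · exact fanTwo_e_ne_q hox hoy h.symm
    · exact hqB h.1
  · exact mem_insert_of_mem _ ⟨hhB, fanTwo_h_ne_p hov⟩
  · rintro (h | h)
    · exact fanTwo_e_ne_p hov hox h.symm
    · exact h.2 rfl

omit heM hov hhM in
/-- **Piece `h ∈ ω`, partner joins `o, v` off `{p, q}`**: toggle `f ↔ q`; lands in `{q, h ∈ ω', p ∉ ω'}` with the same bit set.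
[cite: Linusson2011, Prop. 2.6] [cite: Grimmett2006, §1.5 (p. 13)] -/
theorem fanTwo_piece_h_pos :
    fibreCount M u₀ (forestEv V ∩ {ω | s(o, v) ∈ ω ∧ s(o, y) ∈ ω} ∩ {ω | s(v, x) ∈ ω}ᶜ ∩ {ω | s(x, y) ∈ ω}ᶜ ∩ {ω | s(o, x) ∈ ω} ∩
        {ω | (openGraph (((ω ∆ M) \ {s(x, y)}) \ {s(v, x)})).Reachable o v}) (forestEv V) ≤
      fibreCount M u₀ (forestEv V ∩ {ω | s(o, v) ∈ ω} ∩ {ω | s(x, y) ∈ ω} ∩ {ω | s(o, x) ∈ ω} ∩ {ω | s(v, x) ∈ ω}ᶜ ∩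
        {ω | (openGraph (((ω ∆ M) \ {s(x, y)}) \ {s(v, x)})).Reachable o v}) (forestEv V ∩ {ω | s(o, y) ∈ ω}) := by
  refine fibreCount_exchange_le_of hfM hqM fun ω hω hA hB => ?_
  obtain ⟨⟨⟨⟨⟨hF, he, hf⟩, hp⟩, hq⟩, hh⟩, hR⟩ := hA
  have hp : s(v, x) ∉ ω := hp
  have hq : s(x, y) ∉ ω := hq
  have hB' : IsForestCfg (ω ∆ M) := hB
  have hpB : s(v, x) ∈ ω ∆ M := (mem_symmDiff_iff_not_mem hpM).2 hp
  have hqB : s(x, y) ∈ ω ∆ M := (mem_symmDiff_iff_not_mem hqM).2 hq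
  have hfB : s(o, y) ∉ (ω ∆ M) \ {s(x, y)} := fun h => ((mem_symmDiff_iff_not_mem hfM).1 h.1) hf
  have hsepA : ¬ (openGraph (ω \ {s(o, y)})).Reachable x y := by
    intro hr
    have hox' : (openGraph (ω \ {s(o, y)})).Reachable o x := reach_of_mem_sdiff hh hox (fanTwo_h_ne_f hxy)
    exact not_reachable_sdiff_singleton_of_mem hF hoy hf (hox'.trans hr)
  have hsepB : ¬ (openGraph ((ω ∆ M) \ {s(x, y)})).Reachable o y := by
    intro hr
    have hov' : (openGraph ((ω ∆ M) \ {s(x, y)})).Reachable o v := hR.mono (openGraph_mono sdiff_subset)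
    have hvx' : (openGraph ((ω ∆ M) \ {s(x, y)})).Reachable v x := reach_of_mem_sdiff hpB hvx (fanTwo_p_ne_q hvx hvy)
    exact not_reachable_sdiff_singleton_of_mem hB' hxy hqB ((hvx'.symm.trans hov'.symm).trans hr)
  have hpart : insert s(x, y) (ω \ {s(o, y)}) ∆ M = insert s(o, y) ((ω ∆ M) \ {s(x, y)}) :=
    insert_sdiff_singleton_symmDiff hfM hqM hf hq
  refine ⟨hf, hq, ⟨⟨⟨⟨⟨?_, mem_insert_of_mem _ ⟨he, fanTwo_e_ne_f hvy⟩⟩, mem_insert _ _⟩,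
    mem_insert_of_mem _ ⟨hh, fanTwo_h_ne_f hxy⟩⟩, ?_⟩, ?_⟩, ?_, mem_insert _ _⟩
  · exact (isForestCfg_insert_iff hxy fun h => hq h.1).2 ⟨isForestCfg_of_subset hF sdiff_subset, hsepA⟩
  · rintro (h | h)
    · exact fanTwo_p_ne_q hvx hvy h
    · exact hp h.1
  · show (openGraph (((insert s(x, y) (ω \ {s(o, y)}) ∆ M) \ {s(x, y)}) \ {s(v, x)})).Reachable o v
    rw [hpart]
    exact hR.mono (openGraph_mono fun z hz => ⟨⟨mem_insert_of_mem _ hz.1, hz.1.2⟩, hz.2⟩)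
  · exact (isForestCfg_insert_iff hoy hfB).2 ⟨isForestCfg_of_subset hB' sdiff_subset, hsepB⟩

end Pieces

end FanTwo

end FK
end Summit.CriticalPhenomena.PercolationContinuityZ3.Theorems

end
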